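import Summits.ResolutionOfSingularities.ResolutionOfSingularities.Theorems.PurelyInseparableDim4ResConeLayer
import HarnessLib
import HarnessLib.Audit.Tags

/-!
# Purely inseparable four-folds — (VT)(0): THE DIRECTION OF A SHADE-KEEPING BAND STEP IS A ZERO OF THE
# RESIDUAL CONE, for EVERY residual degree `d ≥ 1` (also `d ≥ p`, where the polar kernel is blind)

[OURS · counted 0 · cell `res-dim4-pi` · seat res-dim4-p-12 g2 · K2(p) lane (desk WORD #66 (2)).]  Nothing
here proves K2(p), `NoIsolatedTrap p p` or resolution of singularities in dimension ≥ 4 / characteristic `p`.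

`…ResConeNear` proved: a point step `s →(j, b) s′` in the band (`x^r ∣ F`, `q < ord₀ F = o < 2q`, `b_j = 0`)
that keeps the shade makes the SHEARED cone `shear j b (resForm s)` free of `x_j`.  Evaluating at `e_j`
turns this into the set-theoretic statement behind [CJS 2020] Thm. 3.14 / Hironaka–Mizutani «near points
lie on the projectivised tangent cone»: **`aeval (direction j b) (resForm s) = 0`** whenever `d = o − |r| ≥ 1`
(`aeval_direction_resForm_eq_zero_of_shade_eq`).  Unlike the polar kernel `resVertex` (which sees only
first polars and is all of `K⁴` when `g ∈ K[x^p]`), this constraint is honest for every `d`, e.g. on the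
`e_G = 4`, `d = p` slice (`…ResConeVertexTop`: `g = Σ cᵢ xᵢ^p`) it reads `c_j + Σ_{i ≠ j} cᵢ bᵢ^p = 0`.
Tools: `prod_single_pow`, `aeval_single_eq_coeff` (a homogeneous `P` of degree `N` evaluates at `e_j` to its
`x_j^N`-coefficient), `aeval_single_shear` (`(shear j b P)(e_j) = P(direction j b)`),
`coeff_single_eq_zero_of_free`.
bears_on: LADDER-RESOLUTION:D157-DOOR2 (res-dim4-pi · K2(p)).  Supports stmt-ResolutionOfSingularities-16155
(helper).
-/

set_option linter.dupNamespace false -- mandated namespace of this single-conjunct summit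

noncomputable section

namespace Summit.ResolutionOfSingularities.ResolutionOfSingularities.Theorems.PIDim4

namespace ResCone

open MvPolynomial Finset
open Literature.AlgebraicGeometry.Resolution
open Literature.AlgebraicGeometry.Resolution.CentreBlowup
open Literature.AlgebraicGeometry.Resolution.Hauser2010
open Literature.AlgebraicGeometry.Resolution.HauserPerlega2019
open PointBlowup (polarMap additiveSubspace direction)

variable {K : Type} [Field K]

/-- A monomial evaluated at the basis vector `e_j`: `1` if it is a pure `x_j`-power, `0` otherwise.
[folklore] -/
theorem prod_single_pow (j : Fin 4) (s : Fin 4 →₀ ℕ) :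
    (s.prod fun i e => (Pi.single j (1 : K) : Fin 4 → K) i ^ e) = if (∀ i, i ≠ j → s i = 0) then 1 else 0 := by
  classical
  split_ifs with h
  · refine Finset.prod_eq_one fun i hi => ?_
    by_cases hij : i = j
    · subst hij; simp only [Pi.single_eq_same, one_pow]
    · exact absurd (h i hij) (Finsupp.mem_support_iff.mp hi)
  · push Not at h
    obtain ⟨i, hij, hi⟩ := h
    exact Finset.prod_eq_zero (Finsupp.mem_support_iff.mpr hi)
      (by simp only [Pi.single_eq_of_ne hij, zero_pow hi])

/-- An exponent supported on `{j}` is `single j (s j)`. [folklore] -/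
theorem eq_single_of_forall_ne {j : Fin 4} {s : Fin 4 →₀ ℕ} (h : ∀ i, i ≠ j → s i = 0) :
    s = Finsupp.single j (s j) := by
  ext i
  by_cases hij : i = j
  · subst hij; rw [Finsupp.single_eq_same]
  · rw [h i hij, Finsupp.single_eq_of_ne hij]

/-- **A homogeneous form of degree `N` evaluates at `e_j` to its `x_j^N`-coefficient.** [folklore] -/
theorem aeval_single_eq_coeff {P : MvPolynomial (Fin 4) K} {N : ℕ} (hP : P.IsHomogeneous N) (j : Fin 4) :
    aeval (Pi.single j (1 : K)) P = coeff (Finsupp.single j N) P := by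
  classical
  conv_lhs => rw [P.as_sum]
  rw [map_sum]
  simp_rw [aeval_monomial, prod_single_pow, Algebra.algebraMap_self, RingHom.id_apply]
  rw [Finset.sum_eq_single (Finsupp.single j N)]
  · rw [if_pos (fun i hij => Finsupp.single_eq_of_ne hij), mul_one]
  · intro s hs hne
    rw [if_neg, mul_zero]
    intro h
    apply hne
    have hdeg : s.degree = N := by
      have := hP (MvPolynomial.mem_support_iff.mp hs)
      rwa [weight_one_eq_degree] at this
    rw [eq_single_of_forall_ne h, Finsupp.degree_single] at hdeg
    rw [eq_single_of_forall_ne h, hdeg]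
  · intro h
    rw [MvPolynomial.notMem_support_iff.mp h, zero_mul]

/-- **Shear, then evaluate at `e_j` = evaluate at the direction**: `(shear j b P)(e_j) = P(e_j + b)`
(`direction j b = update b j 1`). [folklore] -/
theorem aeval_single_shear [DecidableEq K] (j : Fin 4) (b : Fin 4 → K) (P : MvPolynomial (Fin 4) K) :
    aeval (Pi.single j (1 : K)) (shear j b P) = aeval (direction j b) P := by
  have hfun : (fun i => aeval (Pi.single j (1 : K) : Fin 4 → K)
      (if i = j then (X j : MvPolynomial (Fin 4) K) else X i + C (b i) * X j)) = direction j b := by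
    funext i
    unfold direction
    by_cases hij : i = j
    · subst hij
      rw [if_pos rfl, aeval_X, Pi.single_eq_same, Function.update_self]
    · rw [if_neg hij, map_add, map_mul, aeval_X, aeval_X, aeval_C, Pi.single_eq_of_ne hij, Pi.single_eq_same,
        Function.update_of_ne hij, Algebra.algebraMap_self, RingHom.id_apply, zero_add, mul_one]
  unfold shear
  rw [comp_aeval_apply, hfun]

/-- An `x_j`-free polynomial has no pure `x_j^N`-term for `N ≠ 0`. [folklore] -/
theorem coeff_single_eq_zero_of_free {j : Fin 4} {P : MvPolynomial (Fin 4) K}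
    (hfree : ∀ e ∈ P.support, e j = 0) {N : ℕ} (hN : N ≠ 0) : coeff (Finsupp.single j N) P = 0 :=
  MvPolynomial.notMem_support_iff.mp fun h => hN (by simpa using hfree _ h)

/-- **(VT)(0) — THE NEAR DIRECTION IS A ZERO OF THE RESIDUAL CONE** (Hironaka–Mizutani / [CJS 2020] Thm. 3.14,
set-theoretic shadow, frame form, EVERY residual degree `d ≥ 1`): at a point step in the band (`x^r ∣ F`,
`q < ord₀ F = o < 2q`, `b_j = 0`, `|r| < o`) that keeps the shade, `g(e_j + b) = 0` for the residual cone
`g = resForm s`. [OURS] [cite: CossartJannsenSaito2020, Thm. 3.14] -/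
theorem aeval_direction_resForm_eq_zero_of_shade_eq [DecidableEq K] {q : ℕ} (j : Fin 4) {b : Fin 4 → K}
    (hbj : b j = 0) {s : State K} {o : ℕ} (ho : ordZero s.F = o) (hr : ∀ d ∈ s.F.support, s.r ≤ d)
    (hqo : q < o) (ho2 : o < 2 * q) (heq : (CentreBlowup.step q Finset.univ j b s).shade = s.shade)
    (hd : s.r.degree < o) : aeval (direction j b) (resForm s) = 0 := by
  have hfree := shear_resForm_free_of_shade_eq j hbj ho hr hqo ho2 heq
  have hhom : (shear j b (resForm s)).IsHomogeneous (o - s.r.degree) :=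
    isHomogeneous_shear j b (resForm_isHomogeneous ho)
  rw [← aeval_single_shear, aeval_single_eq_coeff hhom, coeff_single_eq_zero_of_free hfree (by omega)]

/-- **Chain form**: along an isolated above-floor `Step0 p` chain with `x^{r₀} ∣ F₀` and constant NON-ZERO
shade, with witnesses `(j k, b k)`, every direction is a zero of the current residual cone:
`(resForm (c k))(e_{j k} + b k) = 0`. [OURS] [cite: CossartJannsenSaito2020, Thm. 3.14] -/
theorem aeval_direction_resForm_eq_zero_of_chain (p : ℕ) [Fact p.Prime] [DecidableEq K] {c : ℕ → State K}
    (hc : ∀ k, IsIsolated p (c k).F ∧ Step0 p (c k) (c (k + 1)))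
    (hr0 : ∀ e ∈ (c 0).F.support, (c 0).r ≤ e) (hfloor : ∀ k, ordZero (c k).F ≠ p) {d : ℕ∞}
    (hshade : ∀ k, (c k).shade = d) (hd : d ≠ 0) {j : ℕ → Fin 4} {b : ℕ → Fin 4 → K}
    (hw : FreeTail.IsWitnessedChain p c j b) (k : ℕ) :
    aeval (direction (j k) (b k)) (resForm (c k)) = 0 := by
  obtain ⟨o, ho, hpo, ho2⟩ := BandShade.exists_ordZero_eq p hc k
  have hpo' : p < o := lt_of_le_of_ne hpo (fun h => hfloor k (by rw [ho, h]))
  have ho2' : o < 2 * p := by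
    have hp : 2 ≤ p := (Fact.out : p.Prime).two_le
    omega
  have hr := IsolatedBand.isolated_chain_forall_le hc hr0 k
  obtain ⟨-, hbk, -, -, hck⟩ := hw k
  have heq : (CentreBlowup.step p Finset.univ (j k) (b k) (c k)).shade = (c k).shade := by
    rw [← hck, hshade, hshade]
  have hdeg : (c k).r.degree < o := by
    have hro := degree_r_le ho hr
    rcases Nat.lt_or_ge (c k).r.degree o with h | h
    · exact h
    · exfalso
      apply hd
      rw [← hshade k, BandShade.shade_eq_coe ho, show o - (c k).r.degree = 0 by omega]
      rfl
  exact aeval_direction_resForm_eq_zero_of_shade_eq (j k) hbk ho hr hpo' ho2' heq hdeg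

end ResCone

end Summit.ResolutionOfSingularities.ResolutionOfSingularities.Theorems.PIDim4

end
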